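import Summits.ValiantsHypothesis.ValiantsHypothesis.Theorems.KPlusLogSqLawStaticPathMixedEventsCount

/-!
# Route «KPlusLogSqLaw» — parametric max-weight independent set on a path: the rectangle / alternating-sum count, SIGNED version (toward THEOREM T′)

HONEST FRAMING.  Helper toward the crux `WeakLifting` (item `stmt-ValiantsHypothesis-19561`, route `KPlusLogSqLaw`, cell `pub-symmetroid`,
seat val-sym-lift-p4 g21, 2026-08-29) on the line of its witness-plan stub `stub_tridiagonalSectorB` (tropical twin of the STATIC tridiagonal
sector = parametric maximum-weight independent set on a path).  The counting lemma of THEOREM T (`…StaticPathMixedEventsCount.card_le_of_unique_tips`,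
val-sym-lift-p4 g14/g20) assumes that the counted pair type `S p q` forces `p + q` odd, so that every event rectangle has signed area `-1`.  THIS
FILE drops that assumption (THEOREM-T.md §4, the «cut lemma» T′): with (U) «every window has at most one tip» and (B) «for fixed `i` the right ends
`j` of windows with a tip form an interval» exactly as before, the rectangle of an event `(p, q)` has signed area `(-1)^(p+q)`, so the window
sum — still a sum of `n + 1` row sums in `{-1, 0, 1}`, the last one `0` — equals `#{events with p + q even} - #{events with p + q odd}`; hence
**`signed_card_le_of_unique_tips`**: `#{S-events with p + q even} ≤ n + #{S-events with p + q odd}`.  (For the λ-low tips of THEOREM T′ the even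
ones are the HOPS whose two slopes straddle `λ`, the odd ones are mixed events, at most `2n` by THEOREM T.)  Statements about finite alternating
sums; nothing here asserts anything about `WeakLifting`, `TropicalB`, `KPlusLogSqLaw`, the stub in its window, `MatrixDescartes`
(stmt-ValiantsHypothesis-18050) or `VP ≠ VNP`.
-/

set_option linter.dupNamespace false
set_option autoImplicit false

namespace Summit.ValiantsHypothesis.ValiantsHypothesis.Theorems.KPlusLogSqLaw

open Finset Classical

namespace StaticPathFold

/-- THE SIGNED COUNTING LEMMA (combinatorial heart of THEOREM T′).  `G p q t` = «line `t` is correct at the vertex of the pair `(p, q)`»,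
`S p q` = «`(p, q)` is a pair of the type being counted» (no parity assumption).  A TIP of the window `[i, j]` is a pair `p < q` of the window
with `S p q` at whose vertex every other index of the window is correct.  If every window has at most one tip (`hU`) and, for fixed `i`, the
`j ≤ n` admitting a tip form an interval (`hB`), then among the pairs `p < q ≤ n` with `S p q` satisfying (M), (L), (R) (as in
`card_le_of_unique_tips`) those with `p + q` EVEN exceed those with `p + q` ODD by at most `n`: the windows whose tip is a given such pair form a
rectangle of signed area `(-1)^(p+q)`, and the total signed area is a sum of `n + 1` row sums in `{-1, 0, 1}`, the last one `0`
(THEOREM-T.md §4, val-sym-lift-p4 g14). [folklore] -/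
theorem signed_card_le_of_unique_tips (n : ℕ) (G : ℕ → ℕ → ℕ → Prop) (S : ℕ → ℕ → Prop)
    (hU : ∀ i j p q p' q', i ≤ p → p < q → q ≤ j → S p q → (∀ t, i ≤ t → t ≤ j → t ≠ p → t ≠ q → G p q t) →
      i ≤ p' → p' < q' → q' ≤ j → S p' q' → (∀ t, i ≤ t → t ≤ j → t ≠ p' → t ≠ q' → G p' q' t) → p = p' ∧ q = q')
    (hB : ∀ i j₁ j₂ j₃, j₁ ≤ j₂ → j₂ ≤ j₃ → j₃ ≤ n →
      (∃ p q, i ≤ p ∧ p < q ∧ q ≤ j₁ ∧ S p q ∧ ∀ t, i ≤ t → t ≤ j₁ → t ≠ p → t ≠ q → G p q t) →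
      (∃ p q, i ≤ p ∧ p < q ∧ q ≤ j₃ ∧ S p q ∧ ∀ t, i ≤ t → t ≤ j₃ → t ≠ p → t ≠ q → G p q t) →
      (∃ p q, i ≤ p ∧ p < q ∧ q ≤ j₂ ∧ S p q ∧ ∀ t, i ≤ t → t ≤ j₂ → t ≠ p → t ≠ q → G p q t)) :
    (((range (n + 1)) ×ˢ (range (n + 1))).filter (fun pq : ℕ × ℕ => pq.1 < pq.2 ∧ pq.2 ≤ n ∧ S pq.1 pq.2 ∧
        (∀ t, pq.1 < t → t < pq.2 → G pq.1 pq.2 t) ∧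
        (∃ r, Even r ∧ r ≤ pq.1 ∧ (∀ t, pq.1 - r ≤ t → t < pq.1 → G pq.1 pq.2 t) ∧ (r = pq.1 ∨ ¬ G pq.1 pq.2 (pq.1 - r - 1))) ∧
        (∃ r, Even r ∧ pq.2 + r ≤ n ∧ (∀ t, pq.2 < t → t ≤ pq.2 + r → G pq.1 pq.2 t) ∧
          (pq.2 + r = n ∨ ¬ G pq.1 pq.2 (pq.2 + r + 1))) ∧ Even (pq.1 + pq.2))).card ≤
      n + (((range (n + 1)) ×ˢ (range (n + 1))).filter (fun pq : ℕ × ℕ => pq.1 < pq.2 ∧ pq.2 ≤ n ∧ S pq.1 pq.2 ∧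
        (∀ t, pq.1 < t → t < pq.2 → G pq.1 pq.2 t) ∧
        (∃ r, Even r ∧ r ≤ pq.1 ∧ (∀ t, pq.1 - r ≤ t → t < pq.1 → G pq.1 pq.2 t) ∧ (r = pq.1 ∨ ¬ G pq.1 pq.2 (pq.1 - r - 1))) ∧
        (∃ r, Even r ∧ pq.2 + r ≤ n ∧ (∀ t, pq.2 < t → t ≤ pq.2 + r → G pq.1 pq.2 t) ∧
          (pq.2 + r = n ∨ ¬ G pq.1 pq.2 (pq.2 + r + 1))) ∧ Odd (pq.1 + pq.2))).card := by
  -- the tip predicate and the window grid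
  obtain ⟨Tip, hTip⟩ : ∃ Tip : ℕ → ℕ → ℕ × ℕ → Prop, ∀ i j pq, Tip i j pq ↔
      (i ≤ pq.1 ∧ pq.1 < pq.2 ∧ pq.2 ≤ j ∧ S pq.1 pq.2 ∧ ∀ t, i ≤ t → t ≤ j → t ≠ pq.1 → t ≠ pq.2 → G pq.1 pq.2 t) :=
    ⟨fun i j pq => i ≤ pq.1 ∧ pq.1 < pq.2 ∧ pq.2 ≤ j ∧ S pq.1 pq.2 ∧ ∀ t, i ≤ t → t ≤ j → t ≠ pq.1 → t ≠ pq.2 → G pq.1 pq.2 t,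
      fun _ _ _ => Iff.rfl⟩
  set P : Finset (ℕ × ℕ) := (range (n + 1)) ×ˢ (range (n + 1)) with hP
  obtain ⟨Ev, hEv⟩ : ∃ Ev : Finset (ℕ × ℕ), Ev = P.filter (fun pq : ℕ × ℕ => pq.1 < pq.2 ∧ pq.2 ≤ n ∧ S pq.1 pq.2 ∧
        (∀ t, pq.1 < t → t < pq.2 → G pq.1 pq.2 t) ∧
        (∃ r, Even r ∧ r ≤ pq.1 ∧ (∀ t, pq.1 - r ≤ t → t < pq.1 → G pq.1 pq.2 t) ∧ (r = pq.1 ∨ ¬ G pq.1 pq.2 (pq.1 - r - 1))) ∧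
        (∃ r, Even r ∧ pq.2 + r ≤ n ∧ (∀ t, pq.2 < t → t ≤ pq.2 + r → G pq.1 pq.2 t) ∧
          (pq.2 + r = n ∨ ¬ G pq.1 pq.2 (pq.2 + r + 1)))) := ⟨_, rfl⟩
  -- the signed count of tips over the window grid
  set F : ℤ := ∑ i ∈ range (n + 1), ∑ j ∈ range (n + 1), (-1 : ℤ) ^ (i + j) * ((P.filter (Tip i j)).card : ℤ) with hF
  -- (1) rectangle identity: for each pair, the signed area of its rectangle of windows
  have hrect : ∀ pq ∈ P, ∑ i ∈ range (n + 1), ∑ j ∈ range (n + 1), (-1 : ℤ) ^ (i + j) * (if Tip i j pq then 1 else 0) =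
      if pq ∈ Ev then (-1) ^ (pq.1 + pq.2) else 0 := by
    rintro ⟨p, q⟩ hpq
    have hpn : p ≤ n := by have := (mem_product.mp hpq).1; rw [mem_range] at this; omega
    have hqn : q ≤ n := by have := (mem_product.mp hpq).2; rw [mem_range] at this; omega
    by_cases hM : p < q ∧ S p q ∧ ∀ t, p < t → t < q → G p q t
    · obtain ⟨hpq', hS', hM'⟩ := hM
      -- the tip windows of the pair form a rectangle: rows × columns
      have htip : ∀ i j, Tip i j (p, q) ↔ ((i ≤ p ∧ ∀ t, i ≤ t → t < p → G p q t) ∧ (q ≤ j ∧ ∀ t, q < t → t ≤ j → G p q t)) := by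
        intro i j
        rw [hTip]
        constructor
        · rintro ⟨hip, -, hqj, -, hall⟩
          exact ⟨⟨hip, fun t h1 h2 => hall t h1 (by omega) (by omega) (by omega)⟩,
            ⟨hqj, fun t h1 h2 => hall t (by omega) h2 (by omega) (by omega)⟩⟩
        · rintro ⟨⟨hip, hrow⟩, ⟨hqj, hcol⟩⟩
          refine ⟨hip, hpq', hqj, hS', fun t h1 h2 h3 h4 => ?_⟩
          rcases lt_trichotomy t p with ht | ht | ht
          · exact hrow t h1 ht
          · exact absurd ht h3
          · rcases lt_trichotomy t q with ht' | ht' | ht'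
            · exact hM' t ht ht'
            · exact absurd ht' h4
            · exact hcol t ht' h2
      have hrow := tipRow_altSum (fun t => G p q t) n p hpn
      have hcol := tipCol_altSum (fun t => G p q t) n q hqn
      -- factor the double sum
      have hfac : ∑ i ∈ range (n + 1), ∑ j ∈ range (n + 1), (-1 : ℤ) ^ (i + j) * (if Tip i j (p, q) then 1 else 0) =
          (∑ i ∈ (range (n + 1)).filter (fun i => i ≤ p ∧ ∀ t, i ≤ t → t < p → G p q t), (-1 : ℤ) ^ i) *
          (∑ j ∈ (range (n + 1)).filter (fun j => q ≤ j ∧ ∀ t, q < t → t ≤ j → G p q t), (-1 : ℤ) ^ j) := by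
        rw [sum_filter, sum_filter, sum_mul_sum]
        apply sum_congr rfl
        intro i _
        apply sum_congr rfl
        intro j _
        rw [htip i j]
        by_cases hi : i ≤ p ∧ ∀ t, i ≤ t → t < p → G p q t
        · by_cases hj : q ≤ j ∧ ∀ t, q < t → t ≤ j → G p q t
          · rw [if_pos ⟨hi, hj⟩, if_pos hi, if_pos hj, pow_add, mul_one]
          · rw [if_neg (fun h => hj h.2), if_neg hj, mul_zero, mul_zero]
        · rw [if_neg (fun h => hi h.1), if_neg hi, zero_mul, mul_zero]
      rw [hfac, hrow, hcol]
      have hev : (p, q) ∈ Ev ↔ ((∃ r, Even r ∧ r ≤ p ∧ (∀ t, p - r ≤ t → t < p → G p q t) ∧ (r = p ∨ ¬ G p q (p - r - 1))) ∧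
          (∃ r, Even r ∧ q + r ≤ n ∧ (∀ t, q < t → t ≤ q + r → G p q t) ∧ (q + r = n ∨ ¬ G p q (q + r + 1)))) := by
        rw [hEv, mem_filter]
        constructor
        · rintro ⟨-, -, -, -, -, hL, hR⟩
          exact ⟨hL, hR⟩
        · rintro ⟨hL, hR⟩
          exact ⟨hpq, hpq', hqn, hS', hM', hL, hR⟩
      by_cases hL : ∃ r, Even r ∧ r ≤ p ∧ (∀ t, p - r ≤ t → t < p → G p q t) ∧ (r = p ∨ ¬ G p q (p - r - 1))
      · by_cases hR : ∃ r, Even r ∧ q + r ≤ n ∧ (∀ t, q < t → t ≤ q + r → G p q t) ∧ (q + r = n ∨ ¬ G p q (q + r + 1))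
        · rw [if_pos hL, if_pos hR, if_pos (hev.mpr ⟨hL, hR⟩), ← pow_add]
        · rw [if_neg hR, mul_zero, if_neg (fun h => hR (hev.mp h).2)]
      · rw [if_neg hL, zero_mul, if_neg (fun h => hL (hev.mp h).1)]
    · -- no tip anywhere, and not an event
      have hnot : ∀ i j, ¬ Tip i j (p, q) := by
        intro i j h
        rw [hTip] at h
        obtain ⟨hip, hpq', hqj, hS', hall⟩ := h
        exact hM ⟨hpq', hS', fun t h1 h2 => hall t (by omega) (by omega) (by omega) (by omega)⟩
      have hnev : (p, q) ∉ Ev := by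
        rw [hEv, mem_filter]
        rintro ⟨-, h1, -, h3, h4, -⟩
        exact hM ⟨h1, h3, h4⟩
      rw [if_neg hnev]
      apply sum_eq_zero
      intro i _
      apply sum_eq_zero
      intro j _
      rw [if_neg (hnot i j), mul_zero]
  -- (2) hence `F` is the signed count of `Ev`
  have hF1 : F = ∑ pq ∈ Ev, (-1 : ℤ) ^ (pq.1 + pq.2) := by
    have h1 : ∀ i j, ((P.filter (Tip i j)).card : ℤ) = ∑ pq ∈ P, (if Tip i j pq then (1 : ℤ) else 0) := by
      intro i j
      rw [card_filter]
      push_cast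
      rfl
    have h2 : F = ∑ pq ∈ P, ∑ i ∈ range (n + 1), ∑ j ∈ range (n + 1), (-1 : ℤ) ^ (i + j) * (if Tip i j pq then 1 else 0) := by
      rw [hF]
      simp_rw [h1, mul_sum]
      rw [sum_congr rfl (fun i _ => sum_comm), sum_comm]
    have hsub : (P.filter fun pq => pq ∈ Ev) = Ev := by
      ext pq
      rw [mem_filter]
      constructor
      · rintro ⟨-, h⟩
        exact h
      · intro h
        refine ⟨?_, h⟩
        rw [hEv] at h
        exact mem_of_mem_filter pq h
    rw [h2, sum_congr rfl hrect, ← sum_filter, hsub]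
  -- (3) row by row: each window has at most one tip, and the tip columns of a row form an interval
  have hcard01 : ∀ i j, ((P.filter (Tip i j)).card : ℤ) = if (P.filter (Tip i j)).Nonempty then 1 else 0 := by
    intro i j
    have hle : (P.filter (Tip i j)).card ≤ 1 := by
      apply card_le_one.mpr
      rintro ⟨p, q⟩ hpq ⟨p', q'⟩ hpq'
      rw [mem_filter, hTip] at hpq hpq'
      obtain ⟨-, h1, h2, h3, h4, h5⟩ := hpq
      obtain ⟨-, h1', h2', h3', h4', h5'⟩ := hpq'
      obtain ⟨rfl, rfl⟩ := hU i j p q p' q' h1 h2 h3 h4 h5 h1' h2' h3' h4' h5'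
      rfl
    split_ifs with hne
    · have := hne.card_pos; omega
    · rw [not_nonempty_iff_eq_empty] at hne; rw [hne]; rfl
  have hrow : ∀ i ∈ range (n + 1), |∑ j ∈ range (n + 1), (-1 : ℤ) ^ (i + j) * ((P.filter (Tip i j)).card : ℤ)| ≤ 1 := by
    intro i _
    have h1 : ∑ j ∈ range (n + 1), (-1 : ℤ) ^ (i + j) * ((P.filter (Tip i j)).card : ℤ) =
        (-1) ^ i * ∑ j ∈ (range (n + 1)).filter (fun j => (P.filter (Tip i j)).Nonempty), (-1 : ℤ) ^ j := by
      rw [mul_sum, sum_filter]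
      apply sum_congr rfl
      intro j _
      rw [hcard01, pow_add]
      split_ifs <;> ring
    rw [h1, abs_mul, abs_pow, abs_neg, abs_one, one_pow, one_mul]
    apply abs_altSum_convex_le
    intro j₁ j₂ j₃ h12 h23 hj₁ hj₃
    rw [mem_filter, mem_range] at hj₁ hj₃ ⊢
    refine ⟨by omega, ?_⟩
    obtain ⟨⟨p₁, q₁⟩, hp₁⟩ := hj₁.2
    obtain ⟨⟨p₃, q₃⟩, hp₃⟩ := hj₃.2
    rw [mem_filter, hTip] at hp₁ hp₃
    obtain ⟨p, q, h1, h2, h3, h4, h5⟩ := hB i j₁ j₂ j₃ h12 h23 (by omega) ⟨p₁, q₁, hp₁.2⟩ ⟨p₃, q₃, hp₃.2⟩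
    refine ⟨(p, q), ?_⟩
    rw [mem_filter, hTip, hP, mem_product, mem_range, mem_range]
    exact ⟨⟨by omega, by omega⟩, h1, h2, h3, h4, h5⟩
  -- the last row is empty
  have hlast : ∑ j ∈ range (n + 1), (-1 : ℤ) ^ (n + j) * ((P.filter (Tip n j)).card : ℤ) = 0 := by
    apply sum_eq_zero
    intro j hj
    rw [mem_range] at hj
    have : P.filter (Tip n j) = ∅ := by
      apply filter_false_of_mem
      rintro ⟨p, q⟩ _ h
      rw [hTip] at h
      obtain ⟨h1, h2, h3, -, -⟩ := h
      simp only at h1 h2 h3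
      omega
    rw [this, card_empty, Nat.cast_zero, mul_zero]
  -- (4) conclusion
  have hFle : |F| ≤ n := by
    rw [hF, sum_range_succ, hlast, add_zero]
    refine (abs_sum_le_sum_abs _ _).trans ?_
    have : ∑ i ∈ range n, |∑ j ∈ range (n + 1), (-1 : ℤ) ^ (i + j) * ((P.filter (Tip i j)).card : ℤ)| ≤ ∑ _i ∈ range n, (1 : ℤ) :=
      sum_le_sum fun i hi => hrow i (by rw [mem_range] at hi ⊢; omega)
    simpa using this
  -- the signed count splits by the parity of `p + q`
  have hsplit : ∑ pq ∈ Ev, (-1 : ℤ) ^ (pq.1 + pq.2) =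
      ((Ev.filter (fun pq => Even (pq.1 + pq.2))).card : ℤ) - ((Ev.filter (fun pq => Odd (pq.1 + pq.2))).card : ℤ) := by
    rw [← sum_filter_add_sum_filter_not Ev (fun pq => Even (pq.1 + pq.2))]
    have e1 : ∑ pq ∈ Ev.filter (fun pq => Even (pq.1 + pq.2)), (-1 : ℤ) ^ (pq.1 + pq.2) =
        ∑ pq ∈ Ev.filter (fun pq => Even (pq.1 + pq.2)), (1 : ℤ) :=
      sum_congr rfl (fun pq hpq => by rw [mem_filter] at hpq; exact Even.neg_one_pow hpq.2)
    have e2 : ∑ pq ∈ Ev.filter (fun pq => ¬ Even (pq.1 + pq.2)), (-1 : ℤ) ^ (pq.1 + pq.2) =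
        ∑ pq ∈ Ev.filter (fun pq => ¬ Even (pq.1 + pq.2)), (-1 : ℤ) :=
      sum_congr rfl (fun pq hpq => by rw [mem_filter] at hpq; exact Odd.neg_one_pow (Nat.not_even_iff_odd.mp hpq.2))
    have e3 : Ev.filter (fun pq => Odd (pq.1 + pq.2)) = Ev.filter (fun pq => ¬ Even (pq.1 + pq.2)) :=
      filter_congr (fun pq _ => by rw [Nat.not_even_iff_odd])
    rw [e1, e2, e3, sum_const, sum_const, nsmul_eq_mul, nsmul_eq_mul]
    ring
  have hEven : Ev.filter (fun pq => Even (pq.1 + pq.2)) = P.filter (fun pq : ℕ × ℕ => pq.1 < pq.2 ∧ pq.2 ≤ n ∧ S pq.1 pq.2 ∧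
        (∀ t, pq.1 < t → t < pq.2 → G pq.1 pq.2 t) ∧
        (∃ r, Even r ∧ r ≤ pq.1 ∧ (∀ t, pq.1 - r ≤ t → t < pq.1 → G pq.1 pq.2 t) ∧ (r = pq.1 ∨ ¬ G pq.1 pq.2 (pq.1 - r - 1))) ∧
        (∃ r, Even r ∧ pq.2 + r ≤ n ∧ (∀ t, pq.2 < t → t ≤ pq.2 + r → G pq.1 pq.2 t) ∧
          (pq.2 + r = n ∨ ¬ G pq.1 pq.2 (pq.2 + r + 1))) ∧ Even (pq.1 + pq.2)) := by
    rw [hEv, filter_filter]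
    apply filter_congr
    intro pq _
    simp only [and_assoc]
  have hOdd : Ev.filter (fun pq => Odd (pq.1 + pq.2)) = P.filter (fun pq : ℕ × ℕ => pq.1 < pq.2 ∧ pq.2 ≤ n ∧ S pq.1 pq.2 ∧
        (∀ t, pq.1 < t → t < pq.2 → G pq.1 pq.2 t) ∧
        (∃ r, Even r ∧ r ≤ pq.1 ∧ (∀ t, pq.1 - r ≤ t → t < pq.1 → G pq.1 pq.2 t) ∧ (r = pq.1 ∨ ¬ G pq.1 pq.2 (pq.1 - r - 1))) ∧
        (∃ r, Even r ∧ pq.2 + r ≤ n ∧ (∀ t, pq.2 < t → t ≤ pq.2 + r → G pq.1 pq.2 t) ∧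
          (pq.2 + r = n ∨ ¬ G pq.1 pq.2 (pq.2 + r + 1))) ∧ Odd (pq.1 + pq.2)) := by
    rw [hEv, filter_filter]
    apply filter_congr
    intro pq _
    simp only [and_assoc]
  rw [← hEven, ← hOdd]
  have : ((Ev.filter (fun pq => Even (pq.1 + pq.2))).card : ℤ) - ((Ev.filter (fun pq => Odd (pq.1 + pq.2))).card : ℤ) ≤ n := by
    rw [← hsplit, ← hF1]
    exact (le_abs_self F).trans hFle
  have h' : ((Ev.filter (fun pq => Even (pq.1 + pq.2))).card : ℤ) ≤
      n + ((Ev.filter (fun pq => Odd (pq.1 + pq.2))).card : ℤ) := by linarith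
  exact_mod_cast h'


end StaticPathFold

end Summit.ValiantsHypothesis.ValiantsHypothesis.Theorems.KPlusLogSqLaw
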